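import Literature.NumberTheory.EllipticCurves.NewformsEqOfHeckeEigenvalueEqProofs
import Literature.NumberTheory.EllipticCurves.NewformsHeckeStableProofs
import Literature.NumberTheory.EllipticCurves.ModularCurveProofs
import Mathlib.NumberTheory.ModularForms.LevelOne.DimensionFormula
import HarnessLib

/-!
# Newforms of `S_k(Γ₀(N))` are pairwise Petersson-orthogonal; at prime level and weight `< 12`
# they span the whole space (proofs only)

Topic `Literature/NumberTheory/EllipticCurves`; namespace
`Literature.NumberTheory.EllipticCurves.ModularForms`. THEOREMS ONLY (no definition, no named
fact; D-0026), assembled from results already PROVED in the tree: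

* `peterssonProduct_eq_zero_of_isNewform0_ne` — **distinct newforms of `S_k(Γ₀(N))` are orthogonal**
  for the Petersson product (Diamond–Shurman Thm. 5.8.2: "the set of newforms … is an orthogonal
  basis"; Atkin–Lehner 1970, Thm. 5). Proof: by strong multiplicity one
  (`IsNewform0.eq_of_heckeEigenvalue_eq_holds`) two distinct newforms have `a_p(f) ≠ a_p(g)` for
  infinitely many primes `p`, hence for some prime `p ∤ N`; `T_p` is self-adjoint for `p ∤ N`
  (`heckeT_selfAdjoint_holds`, Diamond–Shurman Thm. 5.5.3), so `a_p(f)` is real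
  (`IsNewform0.conj_heckeEigenvalue`) and `(a_p(f) − a_p(g))⟨f,g⟩ = 0`.
* `cuspForm_gamma0_one_eq_zero` — `S_k(Γ₀(1)) = 0` for `k < 12` (Mathlib's level-one dimension
  formula `CuspForm.rank_eq_zero_of_weight_lt_twelve`, transported along `Γ₀(1) = SL(2,ℤ)`,
  tree `coe_gamma0_one`).
* `oldSubspace0_eq_bot_of_prime`, `newSubspace0_eq_top_of_prime`, `span_newforms0_eq_top_of_prime`
  — **at prime level `p` and weight `k < 12` there are no old forms**, so the new subspace is
  everything and the newforms SPAN `S_k(Γ₀(p))` (the only proper divisor level is `1`, whose cusp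
  forms vanish; `oldSubspace0_sup_newSubspace0_holds`, `span_newforms0_holds`).

Written for the cell `landau-siegel` (rung F-S3, §C/§B-fam): these are the two structural
hypotheses of `Literature.NumberTheory.LFunctions.bykovskiiFrolenkov2017_theorem11.harmonicSum`
(harmonic second moment of `L_f(½+it)` over the newforms `H_{2k}(N)`), discharged for the family
of the Iwaniec–Sarnak programme at prime level.

## References

* [DiamondShurman2005] F. Diamond, J. Shurman, *A First Course in Modular Forms*, GTM 228,
  Thm. 5.5.3 (adjoints), Def. 5.6.1 / §5.6 (old and new), Thm. 5.8.2 (orthogonal basis of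
  newforms), Thm. 3.5.2 (dimension formulas at level one).
* [AtkinLehner1970] A. O. L. Atkin, J. Lehner, *Hecke operators on `Γ₀(m)`*, Math. Ann. 185 (1970),
  Thm. 4 (multiplicity one), Thm. 5.
-/

noncomputable section

open scoped MatrixGroups
open CongruenceSubgroup Complex

namespace Literature.NumberTheory.EllipticCurves.ModularForms

/-! ### Orthogonality of distinct newforms -/

section Orthogonal

variable {N : ℕ} [NeZero N] {k : ℤ}

omit [NeZero N] in
/-- A normalised form is nonzero: `a_1(f) = 1` while `a_1` is linear (`a_1(0 • f) = 0`).
[cite: DiamondShurman2005, Def. 5.8.1] -/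
private theorem ne_zero_of_isNormalized {f : CuspForm (Gamma0 N) k} (hf : IsNormalized f) :
    f ≠ 0 := by
  intro h0
  have hΓ : (1 : ℝ) ∈ (Gamma0 N : Subgroup (GL (Fin 2) ℝ)).strictPeriods := by
    rw [strictPeriods_Gamma0]; exact AddSubgroup.mem_zmultiples 1
  have h1 : (UpperHalfPlane.qExpansion 1 ⇑f).coeff 1 = 1 := hf
  have hsmul : (0 : ℂ) • f = f := by rw [zero_smul, h0]
  have key : (UpperHalfPlane.qExpansion 1 ⇑((0 : ℂ) • f)).coeff 1 =
      0 * (UpperHalfPlane.qExpansion 1 ⇑f).coeff 1 := by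
    rw [CuspForm.IsGLPos.coe_smul, ModularForm.qExpansion_smul one_pos hΓ, map_smul, smul_eq_mul]
  rw [hsmul, zero_mul, h1] at key
  exact one_ne_zero key

/-- **The Hecke eigenvalues `a_p(f)`, `p ∤ N`, of a newform of `S_k(Γ₀(N))` are real**:
`T_p` is self-adjoint for the Petersson product (`heckeT_selfAdjoint_holds`), so
`conj(a_p)⟨f,f⟩ = ⟨T_p f, f⟩ = ⟨f, T_p f⟩ = a_p⟨f,f⟩` with `⟨f,f⟩ > 0`.
[cite: DiamondShurman2005, Thm. 5.5.3 (with Thm. 5.8.2)] -/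
theorem IsNewform0.conj_heckeEigenvalue {f : CuspForm (Gamma0 N) k} (hf : IsNewform0 f)
    {p : ℕ} (hp : p.Prime) (hpN : ¬ p ∣ N) :
    starRingEnd ℂ (heckeEigenvalue f p) = heckeEigenvalue f p := by
  haveI : NeZero p := ⟨hp.ne_zero⟩
  have hTf : heckeT (Gamma0 N) k p f = heckeEigenvalue f p • f :=
    heckeT_eq_heckeEigenvalue_smul f p (hf.2.1 p hp)
  have h := heckeT_selfAdjoint_holds N k p hp hpN f f
  rw [hTf, peterssonProduct_smul_left, peterssonProduct_smul_right] at h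
  have hff : peterssonProduct (Gamma0 N) k f f ≠ 0 := by
    intro h0
    have hpos := peterssonProduct_self_pos_holds (Gamma0 N) k (ne_zero_of_isNormalized hf.2.2)
    rw [h0, Complex.zero_re] at hpos
    exact lt_irrefl _ hpos
  exact mul_right_cancel₀ hff h

/-- **Distinct newforms are Petersson-orthogonal** (Diamond–Shurman Thm. 5.8.2: the newforms of
`S_k(Γ₀(N))` form an orthogonal basis of the new subspace): for newforms `f ≠ g` of the same level
and weight, `⟨f, g⟩ = 0`. Proof from the tree: strong multiplicity one gives a prime `p ∤ N` with
`a_p(f) ≠ a_p(g)`; self-adjointness of `T_p` and reality of `a_p(f)` give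
`(a_p(f) − a_p(g))·⟨f,g⟩ = 0`. [cite: DiamondShurman2005, Thm. 5.8.2] [cite: AtkinLehner1970, Thm. 4 and Thm. 5] -/
theorem peterssonProduct_eq_zero_of_isNewform0_ne {f g : CuspForm (Gamma0 N) k}
    (hf : IsNewform0 f) (hg : IsNewform0 g) (hfg : f ≠ g) :
    peterssonProduct (Gamma0 N) k f g = 0 := by
  -- infinitely many primes carry different eigenvalues (strong multiplicity one, contrapositive)
  have hinf : ¬ {p : ℕ | p.Prime ∧ heckeEigenvalue f p ≠ heckeEigenvalue g p}.Finite :=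
    fun hfin => hfg (IsNewform0.eq_of_heckeEigenvalue_eq_holds hf hg hfin)
  -- hence one of them does not divide `N`
  obtain ⟨p, hp, hne, hpN⟩ :
      ∃ p : ℕ, p.Prime ∧ heckeEigenvalue f p ≠ heckeEigenvalue g p ∧ ¬ p ∣ N := by
    by_contra hcon
    push Not at hcon
    refine hinf ((Nat.divisors N).finite_toSet.subset ?_)
    rintro p ⟨hp, hne⟩
    exact Nat.mem_divisors.mpr ⟨hcon p hp hne, NeZero.ne N⟩
  haveI : NeZero p := ⟨hp.ne_zero⟩
  have hTf : heckeT (Gamma0 N) k p f = heckeEigenvalue f p • f :=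
    heckeT_eq_heckeEigenvalue_smul f p (hf.2.1 p hp)
  have hTg : heckeT (Gamma0 N) k p g = heckeEigenvalue g p • g :=
    heckeT_eq_heckeEigenvalue_smul g p (hg.2.1 p hp)
  have h := heckeT_selfAdjoint_holds N k p hp hpN f g
  rw [hTf, hTg, peterssonProduct_smul_left, peterssonProduct_smul_right,
    hf.conj_heckeEigenvalue hp hpN] at h
  have h' : (heckeEigenvalue f p - heckeEigenvalue g p) * peterssonProduct (Gamma0 N) k f g = 0 := by
    rw [sub_mul, h, sub_self]
  exact (mul_eq_zero.mp h').resolve_left (sub_ne_zero.mpr hne)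

/-- Set form: the newforms `newforms0 N k` are PAIRWISE orthogonal.
[cite: DiamondShurman2005, Thm. 5.8.2] -/
theorem newforms0_pairwise_orthogonal :
    ∀ f ∈ newforms0 N k, ∀ g ∈ newforms0 N k, f ≠ g → peterssonProduct (Gamma0 N) k f g = 0 :=
  fun _ hf _ hg hfg => peterssonProduct_eq_zero_of_isNewform0_ne hf hg hfg

end Orthogonal

/-! ### No old forms at prime level and weight `< 12` -/

section PrimeLevel

/-- **`S_k(Γ₀(1)) = 0` for `k < 12`**: Mathlib's level-one dimension formula
(`CuspForm.rank_eq_zero_of_weight_lt_twelve`), transported along `Γ₀(1) = SL(2, ℤ)`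
(tree `coe_gamma0_one`). [cite: DiamondShurman2005, Thm. 3.5.2] -/
theorem cuspForm_gamma0_one_eq_zero {k : ℤ} (hk : k < 12) (g : CuspForm (Gamma0 1) k) : g = 0 := by
  have h0 : CuspForm.mcast rfl g coe_gamma0_one.symm = (0 : CuspForm 𝒮ℒ k) :=
    (rank_zero_iff_forall_zero.mp (CuspForm.rank_eq_zero_of_weight_lt_twelve hk)) _
  have hcoe : (⇑(CuspForm.mcast rfl g coe_gamma0_one.symm) : UpperHalfPlane → ℂ) = ⇑g := rfl
  apply DFunLike.coe_injective
  rw [← hcoe, h0]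
  rfl

variable (p : ℕ) [NeZero p] (k : ℤ)

/-- **No old forms at prime level** (weight `< 12`): the old subspace of `S_k(Γ₀(p))` is spanned by
the images of `S_k(Γ₀(1)) = 0` under the two degeneracy maps, hence is `0`.
[cite: DiamondShurman2005, §5.6 (Def. 5.6.1)] [cite: AtkinLehner1970, §2] -/
theorem oldSubspace0_eq_bot_of_prime (hp : p.Prime) (hk : k < 12) : oldSubspace0 p k = ⊥ := by
  unfold oldSubspace0
  refine iSup_eq_bot.mpr fun Md => ?_
  obtain ⟨⟨M, d⟩, hM, hMd⟩ := Md
  have hM1 : M = 1 := by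
    have h := Nat.mem_properDivisors.mp hM
    rcases (Nat.dvd_prime hp).mp h.1 with h1 | h2
    · exact h1
    · exact absurd h2 (ne_of_lt h.2)
  subst hM1
  refine LinearMap.range_eq_bot.mpr ?_
  ext g
  simp only [LinearMap.zero_apply]
  rw [cuspForm_gamma0_one_eq_zero hk g, map_zero]

/-- At prime level and weight `< 12` the new subspace is the whole space
(`S = S^{old} ⊕ S^{new}` with `S^{old} = 0`). [cite: DiamondShurman2005, §5.6 (p. 188)] [cite: AtkinLehner1970, Thm. 5] -/
theorem newSubspace0_eq_top_of_prime (hp : p.Prime) (hk : k < 12) : newSubspace0 p k = ⊤ := by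
  have h := oldSubspace0_sup_newSubspace0_holds p k
  unfold oldSubspace0_sup_newSubspace0 at h
  rwa [oldSubspace0_eq_bot_of_prime p k hp hk, bot_sup_eq] at h

/-- **At prime level `p` and weight `k < 12` the newforms span `S_k(Γ₀(p))`** (multiplicity one:
they span the new subspace, `span_newforms0_holds`; and there are no old forms).
[cite: DiamondShurman2005, Thm. 5.8.2 and Thm. 5.8.3] [cite: AtkinLehner1970, Thm. 5] -/
theorem span_newforms0_eq_top_of_prime (hp : p.Prime) (hk : k < 12) :
    Submodule.span ℂ (newforms0 p k) = ⊤ := by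
  have h := span_newforms0_holds p k
  unfold span_newforms0 at h
  rw [h, newSubspace0_eq_top_of_prime p k hp hk]

end PrimeLevel

end Literature.NumberTheory.EllipticCurves.ModularForms

end
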